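import Literature.MathematicalPhysics.QuantumFieldTheory.Balaban1983to89.B1Eq324BenfattoSect5FreePerturb
import Literature.MathematicalPhysics.QuantumFieldTheory.Balaban1983to89.B1Eq324BenfattoSect5SlotMasses
import HarnessLib

/-!
# `Balaban1983to89.B1Eq324BenfattoSect5Psi3Cumulants` — [BenfattoEtAl1978] §5 (5.24) p. 157 INSIDE THE FREE CUMULANTS: the
# `Ψ₃ = H′^{(l)}` pieces of all boxes of a pavement, removed from / added to a free cumulant of order `k+1`, cost at most
# `2^{k+1}·C_{k+1}·|B|·(A e^{(δ/2)D²d} L^d S)·e^{−(c/2)v}·M_u^k` — EXTENSIVE and exponentially small in the corridor width — PROVED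
# (instantiation (R2a) of `…Sect5FreePerturb`)

statement-level skeleton of published theorems with citation tags; proofs where landed; nothing here is a claim about the
Yang–Mills mass gap

WHY THIS MODULE (cell `pub-ymgap`, seat `dag-n08-b`, node N08; item (R2a) of the `BasicLemmaPrinted` assembly map).  (5.24):
«𝓔(e^{Ψ_□χ_□}) ≥ 𝓔(e^{(Ψ₁+Ψ₂)χ_□}) exp −(const)A b^D e^{−(ϰ/4)b^{3/2}}|□|; i.e. we find that Ψ₃ can be eliminated for b large by the
same argument used in eliminating H_J^{(l)}».  On the free-cumulant side of the assembly (`…Sect5FreeStep`), the current Hamiltonian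
appears as `X = H_{Γ₁} + Σ_□(Ψ₁+Ψ₂)(□) = Ĥ_J − Σ_□Ψ₃(□)`; replacing `Ê₀^T(X; k)` by `Ê₀^T(Ĥ_J; k)` is `…FreePerturb.abs_cumulantOf_add_sub_le`
with the small class `Y = Σ_{□∈B}Ψ₃(□)`, whose `δ`-inflated mass is `≤ |B|·A e^{(δ/2)D²d}·L^d·S(c/2)·e^{−(c/2)v}` because every `Ψ₃`-tuple
reaches from `□′` beyond `Γ₃(□)` (`…Eq524.le_connLength_of_mem_psi3Class`: `d(Δ) ≥ v`), `c = ϰ/2 − (δ/2)D²√d`.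

DICTIONARY.  `Ψ₃(□_m)` class `= crossT J p □′_m Γ₂(□_m) ∖ crossT J p □′_m Γ₃(□_m)` (`…Eq524.psi3_eq_sum`); the pavement's class
`T₃ p = ⋃_{m∈B}` of those (pairwise disjoint: boxes are disjoint, `…Boxes.disjoint_box`); `S(c) = Σ_p |admissible p D|·K(c/p,d)^{p−1}`.

WHAT IS PROVED (theorems only; no definition, no named fact, no `sorry`; axioms standard).
* `tupleSum_psi3Class_eq_sum_psi3` — `Σ_{T₃} = Σ_{m∈B} Ψ₃(□_m)` (the union class IS the sum of the pieces).
* ★ `deltaMass_psi3Class_le` — `𝓜̃(T₃) ≤ |B|·(A·e^{(δ/2)D²d}·e^{−(c/2)v}·L^d·S(c/2))`.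
* ★★ **`abs_cumulantOf_add_psi3_sub_le`** — for ANY class `T_X`: `|Ê₀^T(X + Σ_□Ψ₃; k+1) − Ê₀^T(X; k+1)| ≤
  2^{k+1}·C_{k+1}·|B|·(A e^{(δ/2)D²d} e^{−(c/2)v} L^d S(c/2))·M_u^k`.

HONEST SCOPE / NOT HERE.  The choice `T_X =` class of `H_{Γ₁}+Σ(Ψ₁+Ψ₂)` (so that `X + Σ_□Ψ₃ = Ĥ_J`, `…Eq511.hatH_eq_sum_classes`) and
the (5.34) twin (R2b) are the assembler's / next edition.  `BasicLemmaPrinted` stays OPEN.  NOT summit progress; count-neutral for N08;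
nothing of [Balaban1985UV3] (41)/(47)/(5) is asserted.
-/

open MeasureTheory ProbabilityTheory Finset
open scoped BigOperators Nat

namespace Literature.MathematicalPhysics.QuantumFieldTheory.Balaban1983to89.B1Eq324BenfattoSect5Psi3Cumulants

open _root_.MeasureTheory _root_.ProbabilityTheory
open Literature.Probability.LatticeModels (cumulantOf)
open Literature.MathematicalPhysics.QuantumFieldTheory
open Literature.MathematicalPhysics.QuantumFieldTheory.Balaban1983to89.B1Eq324BenfattoLemma
open Literature.MathematicalPhysics.QuantumFieldTheory.Balaban1983to89.B1Eq324BenfattoSect5Boxes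
open Literature.MathematicalPhysics.QuantumFieldTheory.Balaban1983to89.B1Eq324BenfattoSect5Eq511 (term)
open Literature.MathematicalPhysics.QuantumFieldTheory.Balaban1983to89.B1Eq324BenfattoSect5Eq524
open Literature.MathematicalPhysics.QuantumFieldTheory.Balaban1983to89.B1Eq324BenfattoSect5SlotMasses (classSum_le_card_mul)
open Literature.MathematicalPhysics.QuantumFieldTheory.Balaban1983to89.B1Eq324BenfattoSect5FreePerturb (abs_cumulantOf_add_sub_le)

variable {d : ℕ} {α β : ℝ} {s D : ℕ} {κ : ℝ} {a : Coef d} {J : Finset (B1Eq324BenfattoLemma.Site d)} {L w v : ℕ}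
  {B : Finset (B1Eq324BenfattoLemma.Site d)}

/-- Sums over a union of index sets are at most the sum of the sums (nonnegative terms). [folklore] -/
private theorem sum_biUnion_le_sum_sum {ι τ : Type*} [DecidableEq τ] (T : Finset ι) (Bf : ι → Finset τ) (W : τ → ℝ)
    (hW : ∀ b, 0 ≤ W b) : ∑ b ∈ T.biUnion Bf, W b ≤ ∑ a ∈ T, ∑ b ∈ Bf a, W b := by
  classical
  induction T using Finset.induction_on with
  | empty => simp
  | insert a T ha ih =>
    rw [Finset.biUnion_insert, Finset.sum_insert ha]
    have hu : ∑ b ∈ Bf a ∪ T.biUnion Bf, W b ≤ ∑ b ∈ Bf a, W b + ∑ b ∈ T.biUnion Bf, W b := by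
      rw [← Finset.sum_union_inter]
      have : 0 ≤ ∑ b ∈ Bf a ∩ T.biUnion Bf, W b := Finset.sum_nonneg fun b _ => hW b
      linarith
    linarith

/-- The `Ψ₃`-tuples of box `□_m` lie inside `□_m`. [cite: BenfattoEtAl1978, (5.23) p.157] -/
private theorem mem_box_of_mem_psi3Class {m : B1Eq324BenfattoLemma.Site d} {p : ℕ} {Δ : Fin p → J}
    (hΔ : Δ ∈ crossT J p (core L w m) (frame2 L w m) \ crossT J p (core L w m) (frame3 L w v m)) (i : Fin p) :
    (Δ i : B1Eq324BenfattoLemma.Site d) ∈ box L m := by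
  have h := (mem_crossT.1 (Finset.mem_sdiff.1 hΔ).1).1 i
  rcases Finset.mem_union.1 h with hc | hf
  · rw [core] at hc; exact shrink_subset_box L m _ hc
  · rw [frame2] at hf; exact shrink_subset_box L m _ (Finset.sdiff_subset hf)

/-- **THE PAVEMENT'S `Ψ₃` CLASS IS THE SUM OF THE BOXES' `Ψ₃`** (boxes pairwise disjoint). [cite: BenfattoEtAl1978, (5.23)–(5.24) p.157] -/
theorem tupleSum_psi3Class_eq_sum_psi3 (hL : 0 < L) (hJ : CoefSupportedIn a J) (hv : v ≤ w) (z : B1Eq324BenfattoLemma.Site d → ℝ) :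
    (∑ p ∈ Finset.Icc 1 s, ∑ Δ ∈ B.biUnion (fun m =>
        crossT J p (core L w m) (frame2 L w m) \ crossT J p (core L w m) (frame3 L w v m)), ∑ n ∈ admissible p D, term κ a z p Δ n) =
      ∑ m ∈ B, psi3 s D κ a L w v m z := by
  classical
  have hdisj : ∀ p ∈ Finset.Icc 1 s, ∀ m₁ ∈ B, ∀ m₂ ∈ B, m₁ ≠ m₂ →
      Disjoint (crossT J p (core L w m₁) (frame2 L w m₁) \ crossT J p (core L w m₁) (frame3 L w v m₁))
        (crossT J p (core L w m₂) (frame2 L w m₂) \ crossT J p (core L w m₂) (frame3 L w v m₂)) := by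
    intro p hp m₁ _ m₂ _ hne
    have hp1 : 0 < p := (Finset.mem_Icc.1 hp).1
    refine Finset.disjoint_left.2 fun Δ h1 h2 => ?_
    exact Finset.disjoint_left.1 (disjoint_box hL hne) (mem_box_of_mem_psi3Class h1 ⟨0, hp1⟩)
      (mem_box_of_mem_psi3Class h2 ⟨0, hp1⟩)
  rw [Finset.sum_congr rfl (fun p hp => Finset.sum_biUnion (fun m₁ h₁ m₂ h₂ hne => hdisj p hp m₁ h₁ m₂ h₂ hne)), Finset.sum_comm]
  exact Finset.sum_congr rfl fun m _ => (psi3_eq_sum hJ hv z).symm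
set_option maxHeartbeats 400000 in
/-- **THE `δ`-INFLATED MASS OF THE PAVEMENT'S `Ψ₃` CLASS** («Ψ₃ can be eliminated … e^{−(ϰ/4)b^{3/2}}|□|», here per pavement):
`𝓜̃(T₃) ≤ |B|·(A·e^{(δ/2)D²d}·e^{−(c/2)v}·L^d·S(c/2))`, `c = ϰ/2 − (δ/2)D²√d > 0`, since every `Ψ₃`-tuple has `d(Δ) ≥ v`
(`…Eq524.le_connLength_of_mem_psi3Class`) and lies in its box (`|□| ≤ L^d`). [cite: BenfattoEtAl1978, (5.24) p.157] -/
theorem deltaMass_psi3Class_le {δ A : ℝ} (hres : 0 < κ / 2 - δ / 2 * ((D : ℝ) ^ 2 * Real.sqrt d)) (hA0 : 0 ≤ A)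
    (hA : ∀ (p : ℕ) (Δ : Fin p → B1Eq324BenfattoLemma.Site d) (n : Fin p → ℕ), |a p Δ n| ≤ A) (hv : v ≤ 2 * w) :
    ∑ p ∈ Finset.Icc 1 s, ∑ Δ ∈ B.biUnion (fun m =>
        crossT J p (core L w m) (frame2 L w m) \ crossT J p (core L w m) (frame3 L w v m)), ∑ n ∈ admissible p D,
        |a p (fun i => (Δ i : B1Eq324BenfattoLemma.Site d)) n| *
          Real.exp (-(κ / 2) * connLength fun i => (Δ i : B1Eq324BenfattoLemma.Site d)) *
          Real.exp (δ / 2 * ((D : ℝ) ^ 2 * (Real.sqrt d * connLength (fun i => (Δ i : B1Eq324BenfattoLemma.Site d)) + d))) ≤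
      B.card * (A * Real.exp (δ / 2 * ((D : ℝ) ^ 2 * d)) * Real.exp (-((κ / 2 - δ / 2 * ((D : ℝ) ^ 2 * Real.sqrt d)) / 2 * v)) *
        (L : ℝ) ^ d * ∑ p ∈ Finset.Icc 1 s, ((admissible p D).card : ℝ) *
          ((2 / (1 - Real.exp (-((κ / 2 - δ / 2 * ((D : ℝ) ^ 2 * Real.sqrt d)) / 2 / (p : ℕ) / Real.sqrt d))) *
            Real.exp ((κ / 2 - δ / 2 * ((D : ℝ) ^ 2 * Real.sqrt d)) / 2 / (p : ℕ) / Real.sqrt d)) ^ d) ^ (p - 1)) := by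
  classical
  set c : ℝ := κ / 2 - δ / 2 * ((D : ℝ) ^ 2 * Real.sqrt d) with hc
  set A' : ℝ := A * Real.exp (δ / 2 * ((D : ℝ) ^ 2 * d)) * Real.exp (-(c / 2 * v)) with hA'
  set S : ℝ := ∑ p ∈ Finset.Icc 1 s, ((admissible p D).card : ℝ) *
      ((2 / (1 - Real.exp (-(c / 2 / (p : ℕ) / Real.sqrt d))) * Real.exp (c / 2 / (p : ℕ) / Real.sqrt d)) ^ d) ^ (p - 1) with hS
  have hA'0 : 0 ≤ A' := by positivity
  have hKnn : ∀ t : ℝ, 0 ≤ t → 0 ≤ 2 / (1 - Real.exp (-t)) := fun t ht =>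
    div_nonneg zero_le_two (by rw [sub_nonneg, Real.exp_le_one_iff, neg_nonpos]; exact ht)
  have hS0 : 0 ≤ S := Finset.sum_nonneg fun p _ => mul_nonneg (Nat.cast_nonneg _) (pow_nonneg (pow_nonneg (mul_nonneg
    (hKnn _ (div_nonneg (div_nonneg (half_pos hres).le (Nat.cast_nonneg _)) (Real.sqrt_nonneg _))) (Real.exp_pos _).le) _) _)
  -- per box
  have hbox : ∀ m ∈ B, ∑ p ∈ Finset.Icc 1 s,
      ∑ Δ ∈ crossT J p (core L w m) (frame2 L w m) \ crossT J p (core L w m) (frame3 L w v m), ∑ n ∈ admissible p D,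
        |a p (fun i => (Δ i : B1Eq324BenfattoLemma.Site d)) n| *
          Real.exp (-(κ / 2) * connLength fun i => (Δ i : B1Eq324BenfattoLemma.Site d)) *
          Real.exp (δ / 2 * ((D : ℝ) ^ 2 * (Real.sqrt d * connLength (fun i => (Δ i : B1Eq324BenfattoLemma.Site d)) + d))) ≤
      A' * (L : ℝ) ^ d * S := by
    intro m _
    have h := classSum_le_card_mul (s := s) (D := D) (half_pos hres) hA'0
      (fun p => crossT J p (core L w m) (frame2 L w m) \ crossT J p (core L w m) (frame3 L w v m)) (box L m)
      (fun p _ Δ hΔ i => mem_box_of_mem_psi3Class hΔ i) _ (fun p _ Δ hΔ n _ => by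
        set ℓ := connLength (fun i => (Δ i : B1Eq324BenfattoLemma.Site d)) with hℓ
        have hℓv : (v : ℝ) ≤ ℓ := le_connLength_of_mem_psi3Class hv hΔ
        have hexp : Real.exp (-(κ / 2) * ℓ) * Real.exp (δ / 2 * ((D : ℝ) ^ 2 * (Real.sqrt d * ℓ + d))) =
            Real.exp (δ / 2 * ((D : ℝ) ^ 2 * d)) * Real.exp (-(c * ℓ)) := by
          rw [← Real.exp_add, ← Real.exp_add]; congr 1; rw [hc]; ring
        have hsplit : Real.exp (-(c * ℓ)) ≤ Real.exp (-(c / 2 * v)) * Real.exp (-(c / 2 * ℓ)) := by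
          rw [← Real.exp_add]
          refine Real.exp_le_exp.2 ?_
          have hc0 : 0 ≤ c := hres.le
          nlinarith
        calc |a p (fun i => (Δ i : B1Eq324BenfattoLemma.Site d)) n| * Real.exp (-(κ / 2) * ℓ) *
              Real.exp (δ / 2 * ((D : ℝ) ^ 2 * (Real.sqrt d * ℓ + d)))
            = |a p (fun i => (Δ i : B1Eq324BenfattoLemma.Site d)) n| *
                (Real.exp (δ / 2 * ((D : ℝ) ^ 2 * d)) * Real.exp (-(c * ℓ))) := by rw [mul_assoc, hexp]
          _ ≤ A * (Real.exp (δ / 2 * ((D : ℝ) ^ 2 * d)) * (Real.exp (-(c / 2 * v)) * Real.exp (-(c / 2 * ℓ)))) :=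
              mul_le_mul (hA p _ n) (mul_le_mul_of_nonneg_left hsplit (Real.exp_pos _).le) (by positivity) hA0
          _ = A' * Real.exp (-(c / 2 * ℓ)) := by rw [hA']; ring)
    refine h.trans ?_
    have hcard : ((box L m).card : ℝ) ≤ (L : ℝ) ^ d := by
      rw [← shrink_zero]; exact_mod_cast card_shrink_le L m 0
    calc A' * ((box L m).card : ℝ) * S ≤ A' * (L : ℝ) ^ d * S :=
          mul_le_mul_of_nonneg_right (mul_le_mul_of_nonneg_left hcard hA'0) hS0
      _ = _ := rfl
  have hnn : ∀ p (Δ : Fin p → J) (n : Fin p → ℕ), 0 ≤ |a p (fun i => (Δ i : B1Eq324BenfattoLemma.Site d)) n| *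
      Real.exp (-(κ / 2) * connLength fun i => (Δ i : B1Eq324BenfattoLemma.Site d)) *
      Real.exp (δ / 2 * ((D : ℝ) ^ 2 * (Real.sqrt d * connLength (fun i => (Δ i : B1Eq324BenfattoLemma.Site d)) + d))) :=
    fun p Δ n => mul_nonneg (mul_nonneg (abs_nonneg _) (Real.exp_pos _).le) (Real.exp_pos _).le
  calc _ ≤ ∑ p ∈ Finset.Icc 1 s, ∑ m ∈ B,
        ∑ Δ ∈ crossT J p (core L w m) (frame2 L w m) \ crossT J p (core L w m) (frame3 L w v m), ∑ n ∈ admissible p D,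
          |a p (fun i => (Δ i : B1Eq324BenfattoLemma.Site d)) n| *
            Real.exp (-(κ / 2) * connLength fun i => (Δ i : B1Eq324BenfattoLemma.Site d)) *
            Real.exp (δ / 2 * ((D : ℝ) ^ 2 * (Real.sqrt d * connLength (fun i => (Δ i : B1Eq324BenfattoLemma.Site d)) + d))) :=
        Finset.sum_le_sum fun p _ => sum_biUnion_le_sum_sum _ _ _ fun Δ => Finset.sum_nonneg fun n _ => hnn p Δ n
    _ = ∑ m ∈ B, ∑ p ∈ Finset.Icc 1 s,
        ∑ Δ ∈ crossT J p (core L w m) (frame2 L w m) \ crossT J p (core L w m) (frame3 L w v m), ∑ n ∈ admissible p D,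
          |a p (fun i => (Δ i : B1Eq324BenfattoLemma.Site d)) n| *
            Real.exp (-(κ / 2) * connLength fun i => (Δ i : B1Eq324BenfattoLemma.Site d)) *
            Real.exp (δ / 2 * ((D : ℝ) ^ 2 * (Real.sqrt d * connLength (fun i => (Δ i : B1Eq324BenfattoLemma.Site d)) + d))) :=
        Finset.sum_comm
    _ ≤ ∑ _m ∈ B, A' * (L : ℝ) ^ d * S := Finset.sum_le_sum hbox
    _ = _ := by rw [Finset.sum_const, nsmul_eq_mul, hA', hS]

/-- **(5.24) INSIDE THE FREE CUMULANTS**: for ANY tuple class `T_X` and the pavement's `Ψ₃` class `T₃`, under `P̂₀`,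
`|Ê₀^T(X + Σ_□Ψ₃; k+1) − Ê₀^T(X; k+1)| ≤ 2^{k+1}·2^{(k+1)D}2^{2^{(k+1)D}}K₀^{(k+1)D}·[|B|·A e^{(δ/2)D²d} e^{−(c/2)v} L^d S(c/2)]·M_u^k`
(`…FreePerturb.abs_cumulantOf_add_sub_le` + `deltaMass_psi3Class_le`). [cite: BenfattoEtAl1978, (5.24) p.157, §5 p.159] -/
theorem abs_cumulantOf_add_psi3_sub_le (hα : 0 < α) (hβ : 0 < β) (hd : 0 < d) {δ A : ℝ}
    (hres : 0 < κ / 2 - δ / 2 * ((D : ℝ) ^ 2 * Real.sqrt d)) (hδ : 0 < δ) (hδle : δ ≤ Real.log ((2 * d + α ^ 2) / (2 * d)))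
    (hA0 : 0 ≤ A) (hA : ∀ (p : ℕ) (Δ : Fin p → B1Eq324BenfattoLemma.Site d) (n : Fin p → ℕ), |a p Δ n| ≤ A) (hv : v ≤ 2 * w)
    (TX : (p : ℕ) → Finset (Fin p → J)) (k : ℕ) :
    |cumulantOf (fun r => ∫ z, ((∑ p ∈ Finset.Icc 1 s, ∑ Δ ∈ TX p, ∑ n ∈ admissible p D, term κ a z p Δ n) +
          (∑ p ∈ Finset.Icc 1 s, ∑ Δ ∈ B.biUnion (fun m =>
            crossT J p (core L w m) (frame2 L w m) \ crossT J p (core L w m) (frame3 L w v m)),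
            ∑ n ∈ admissible p D, term κ a z p Δ n)) ^ r ∂P0 d α β) (k + 1) -
      cumulantOf (fun r => ∫ z, (∑ p ∈ Finset.Icc 1 s, ∑ Δ ∈ TX p, ∑ n ∈ admissible p D, term κ a z p Δ n) ^ r ∂P0 d α β)
        (k + 1)| ≤
      2 ^ (k + 1) * (2 ^ ((k + 1) * D) * 2 ^ 2 ^ ((k + 1) * D) * (max 1 (freeCov d α β 0 0)) ^ ((k + 1) * D)) *
        (B.card * (A * Real.exp (δ / 2 * ((D : ℝ) ^ 2 * d)) * Real.exp (-((κ / 2 - δ / 2 * ((D : ℝ) ^ 2 * Real.sqrt d)) / 2 * v)) *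
          (L : ℝ) ^ d * ∑ p ∈ Finset.Icc 1 s, ((admissible p D).card : ℝ) *
            ((2 / (1 - Real.exp (-((κ / 2 - δ / 2 * ((D : ℝ) ^ 2 * Real.sqrt d)) / 2 / (p : ℕ) / Real.sqrt d))) *
              Real.exp ((κ / 2 - δ / 2 * ((D : ℝ) ^ 2 * Real.sqrt d)) / 2 / (p : ℕ) / Real.sqrt d)) ^ d) ^ (p - 1))) *
        (A * Real.exp (δ / 2 * ((D : ℝ) ^ 2 * d)) *
          (2 / (1 - Real.exp (-(δ / (2 * ((k + 1 : ℕ) : ℝ)) / Real.sqrt d))) * Real.exp (δ / (2 * ((k + 1 : ℕ) : ℝ)) / Real.sqrt d)) ^ d *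
          ∑ p ∈ Finset.Icc 1 s, ((admissible p D).card : ℝ) *
            ((2 / (1 - Real.exp (-((κ / 2 - δ / 2 * ((D : ℝ) ^ 2 * Real.sqrt d)) / (p : ℕ) / Real.sqrt d))) *
              Real.exp ((κ / 2 - δ / 2 * ((D : ℝ) ^ 2 * Real.sqrt d)) / (p : ℕ) / Real.sqrt d)) ^ d) ^ (p - 1)) ^ k := by
  refine (abs_cumulantOf_add_sub_le hα hβ hd hres hδ hδle hA0 hA TX _ k).trans ?_
  have hKnn : ∀ t : ℝ, 0 ≤ t → 0 ≤ 2 / (1 - Real.exp (-t)) := fun t ht =>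
    div_nonneg zero_le_two (by rw [sub_nonneg, Real.exp_le_one_iff, neg_nonpos]; exact ht)
  have hc₂ : 0 ≤ δ / (2 * ((k + 1 : ℕ) : ℝ)) := by positivity
  have hMu0 : 0 ≤ A * Real.exp (δ / 2 * ((D : ℝ) ^ 2 * d)) *
      (2 / (1 - Real.exp (-(δ / (2 * ((k + 1 : ℕ) : ℝ)) / Real.sqrt d))) * Real.exp (δ / (2 * ((k + 1 : ℕ) : ℝ)) / Real.sqrt d)) ^ d *
      ∑ p ∈ Finset.Icc 1 s, ((admissible p D).card : ℝ) *
        ((2 / (1 - Real.exp (-((κ / 2 - δ / 2 * ((D : ℝ) ^ 2 * Real.sqrt d)) / (p : ℕ) / Real.sqrt d))) *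
          Real.exp ((κ / 2 - δ / 2 * ((D : ℝ) ^ 2 * Real.sqrt d)) / (p : ℕ) / Real.sqrt d)) ^ d) ^ (p - 1) :=
    mul_nonneg (mul_nonneg (mul_nonneg hA0 (Real.exp_pos _).le)
      (pow_nonneg (mul_nonneg (hKnn _ (div_nonneg hc₂ (Real.sqrt_nonneg _))) (Real.exp_pos _).le) _))
      (Finset.sum_nonneg fun p _ => mul_nonneg (Nat.cast_nonneg _) (pow_nonneg (pow_nonneg (mul_nonneg
        (hKnn _ (div_nonneg (div_nonneg hres.le (Nat.cast_nonneg _)) (Real.sqrt_nonneg _))) (Real.exp_pos _).le) _) _))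
  exact mul_le_mul_of_nonneg_right (mul_le_mul_of_nonneg_left (deltaMass_psi3Class_le hres hA0 hA hv) (by positivity))
    (pow_nonneg hMu0 _)

end Literature.MathematicalPhysics.QuantumFieldTheory.Balaban1983to89.B1Eq324BenfattoSect5Psi3Cumulants
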